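import Literature.NumberTheory.EllipticCurves.Sprung2017.HalfLogarithmMatrixInvolutionOffDiagProofs
import HarnessLib

/-!
# Sprung 2017, §3.4 (Prop. 3.14) at `(p, a_p) = (3, 3b)`: the transition matrix `M` of `ℒ(T) = M(T)·ℒ(T^ι)` is UNIQUE,
# and its lower off-diagonal entry is `M₁₀ = 3·T·g` with `g(0) ≠ 0` when `3 ∤ b` — proofs only

A *proofs* companion (theorems only; no definition, no named fact) of `HalfLogarithmMatrixInvolutionProofs` (p634584),
`HalfLogarithmMatrixInvolutionModThreeProofs` (p638807) and `HalfLogarithmMatrixInvolutionOffDiagProofs` (p641447: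
`M ≡ 1 (mod T)`, `3 ∣ M₀₁, M₁₀`, `M₀₁ = C(3)·T·(unit)` for `3 ∤ b`).

## What is proved

* §1 the constant terms `w_m = v_m(0)` of the ♭-row (`v_0 = 1`, `v_1 = 0`, `w_{m+2} = 3(b·w_{m+1} − w_m)`):
  `3^k ∣ w_{2k}`, `3^{k+1} ∣ w_{2k+1}`, hence `3^{m+1} ∣ w_m w_{m+1}`, and for `n ≥ 4`
  `2·Σ_{m<n} w_m w_{m+1} ≡ −108b (mod 243)` (`w_2 w_3 = 27b`, `w_3 w_4 = −81b + 243b³`);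
* §2–§4 carrying `[T¹](M_n)₁₀ = −2·Σ_{m<n} v_m(0)v_{m+1}(0)` (`[T¹](E_{m+1})₁₀ = −g(0)v_m(0)v_{m+1}(0)`, `g(0) = 2`)
  through the induction `M_{n+1} = E_{n+1}M_n` and the compactness limit: there is a transition matrix with
  `243 ∣ [T¹]M₁₀ − 108b` (`exists_integral_halfLogMatrix_eq_mul_subst_lower`);
* §5 **`halfLogMatrix_transition_unique`** — the integral transition matrix is UNIQUE (`det ℒ(T^ι) ≠ 0` in the domain
  `ℚ_3⟦T⟧`), so the invariants of the four companion files hold for ONE AND THE SAME `M = ℒ·ℒ(T^ι)⁻¹`;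
* §6 **`exists_integral_halfLogMatrix_offDiag_both`** — for `3 ∤ b`: `M₀₁ = C(3)·T·u` with `u ∈ Λˣ` AND
  `M₁₀ = C(3)·T·g` with `g(0) ≠ 0` (indeed `81 ∣ g(0) − 36b`), `M₀₀(0) = M₁₁(0) = 1`.

CONSUMER (Summits side, crux `SprungLowerDivisibilityAtThree`, line `chromatic-common-zeros`): the ♯-row
`κ′·L♯(T^ι) − m₀₀·L♯ = 3T·g·L♭` with `ord_T g = 0` gives the SYMMETRIC half of the order-of-vanishing dichotomy,
`|ord_T L♯ − ord_T L♭| ≤ 1`. HONEST FRAMING: elementary algebra + compactness about the tree's own definitions; special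
case `p = 3`; nothing about any curve; BSD is not proved by any of this.

References: [Sprung2017] §3.1, §3.4 Prop. 3.14, Cor. 4.4, Cor. 4.6; [GreenbergLNM1716] §1.
-/

noncomputable section

open scoped MatrixGroups

open Polynomial Filter Topology Literature.Barriers.BirchSwinnertonDyer

namespace Literature.NumberTheory.EllipticCurves.Sprung2017

/-! ## §1 Constant terms of `v_n` at `a = 3b` -/

section ConstantTerms

/-- The constant-term recursion `v_{n+2}(0) = 3·(b·v_{n+1}(0) − v_n(0))` at `a = 3b` (`Φ_{3^{n+1}}(1) = 3`).
[cite: Sprung2017, Cor. 4.4] -/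
theorem coeff_zero_flatPoly_add_two (b : ℤ) (n : ℕ) :
    (flatPoly (3 * b) 3 (n + 2)).coeff 0 =
      3 * (b * (flatPoly (3 * b) 3 (n + 1)).coeff 0 - (flatPoly (3 * b) 3 n).coeff 0) := by
  rw [flatPoly_add_two, coeff_sub, coeff_C_mul, mul_coeff_zero, coeff_zero_cyclotomic_three_pow_succ_comp]
  ring

/-- **`3`-adic growth of `v_m(0)`**: `3^k ∣ v_{2k}(0)` and `3^{k+1} ∣ v_{2k+1}(0)` (`v_0 = 1`, `v_1 = 0`).
[cite: Sprung2017, Cor. 4.4] -/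
theorem pow_dvd_coeff_zero_flatPoly (b : ℤ) (k : ℕ) :
    (3 : ℤ) ^ k ∣ (flatPoly (3 * b) 3 (2 * k)).coeff 0 ∧
      (3 : ℤ) ^ (k + 1) ∣ (flatPoly (3 * b) 3 (2 * k + 1)).coeff 0 := by
  induction k with
  | zero => exact ⟨by simp, by simp⟩
  | succ k ih =>
    obtain ⟨h0, h1⟩ := ih
    have h2 : (3 : ℤ) ^ (k + 1) ∣ (flatPoly (3 * b) 3 (2 * (k + 1))).coeff 0 := by
      rw [show 2 * (k + 1) = 2 * k + 2 from by ring, coeff_zero_flatPoly_add_two, pow_succ']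
      refine mul_dvd_mul_left 3 (dvd_sub (Dvd.dvd.mul_left ?_ b) h0)
      exact dvd_trans (pow_dvd_pow 3 k.le_succ) h1
    refine ⟨h2, ?_⟩
    rw [show 2 * (k + 1) + 1 = (2 * k + 1) + 2 from by ring, coeff_zero_flatPoly_add_two, pow_succ' (3 : ℤ) (k + 1)]
    refine mul_dvd_mul_left 3 (dvd_sub (Dvd.dvd.mul_left ?_ b) h1)
    rw [show 2 * k + 1 + 1 = 2 * (k + 1) from by ring]
    exact h2

/-- `3^{m+1} ∣ v_m(0)·v_{m+1}(0)`. [cite: Sprung2017, Cor. 4.4] -/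
theorem pow_succ_dvd_coeff_zero_flatPoly_mul_succ (b : ℤ) (m : ℕ) :
    (3 : ℤ) ^ (m + 1) ∣ (flatPoly (3 * b) 3 m).coeff 0 * (flatPoly (3 * b) 3 (m + 1)).coeff 0 := by
  obtain ⟨k, rfl | rfl⟩ := Nat.even_or_odd' m
  · obtain ⟨h0, h1⟩ := pow_dvd_coeff_zero_flatPoly b k
    have hp : (3 : ℤ) ^ (2 * k + 1) = 3 ^ k * 3 ^ (k + 1) := by rw [← pow_add]; congr 1; ring
    rw [hp]
    exact mul_dvd_mul h0 h1
  · obtain ⟨-, h1⟩ := pow_dvd_coeff_zero_flatPoly b k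
    obtain ⟨h2, -⟩ := pow_dvd_coeff_zero_flatPoly b (k + 1)
    have hp : (3 : ℤ) ^ (2 * k + 1 + 1) = 3 ^ (k + 1) * 3 ^ (k + 1) := by rw [← pow_add]; congr 1; ring
    have hi : 2 * k + 1 + 1 = 2 * (k + 1) := by ring
    rw [hp, hi]
    exact mul_dvd_mul h1 h2

/-- **The `T¹`-congruence of the lower entry**: for `n ≥ 4`, `2·Σ_{m<n} v_m(0)v_{m+1}(0) ≡ −108b (mod 243)`
(`v_2(0)v_3(0) = 27b`, `v_3(0)v_4(0) = −81b + 243b³`, `243 ∣ v_m(0)v_{m+1}(0)` for `m ≥ 4`). [cite: Sprung2017, Cor. 4.4] -/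
theorem dvd_two_mul_sum_flat_add (b : ℤ) (n : ℕ) (hn : 4 ≤ n) :
    (243 : ℤ) ∣ 2 * (∑ m ∈ Finset.range n,
        (flatPoly (3 * b) 3 m).coeff 0 * (flatPoly (3 * b) 3 (m + 1)).coeff 0) + 108 * b := by
  induction n, hn using Nat.le_induction with
  | base =>
    have h2 : (flatPoly (3 * b) 3 2).coeff 0 = -3 := by
      have h := coeff_zero_flatPoly_add_two b 0
      simp only [zero_add, flatPoly_one, flatPoly_zero, coeff_zero, coeff_one_zero] at h
      rw [h]; ring
    have h3 : (flatPoly (3 * b) 3 3).coeff 0 = -9 * b := by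
      have h := coeff_zero_flatPoly_add_two b 1
      rw [show 1 + 2 = 3 from rfl, show 1 + 1 = 2 from rfl, h2, flatPoly_one, coeff_zero] at h
      rw [h]; ring
    have h4 : (flatPoly (3 * b) 3 4).coeff 0 = 9 - 27 * b ^ 2 := by
      have h := coeff_zero_flatPoly_add_two b 2
      rw [show 2 + 2 = 4 from rfl, show 2 + 1 = 3 from rfl, h3, h2] at h
      rw [h]; ring
    simp only [Finset.sum_range_succ, Finset.sum_range_zero, Nat.reduceAdd, zero_add, flatPoly_zero, flatPoly_one,
      coeff_zero, coeff_one_zero, h2, h3, h4]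
    exact ⟨2 * b ^ 3, by ring⟩
  | succ n hn ih =>
    rw [Finset.sum_range_succ, mul_add, add_right_comm]
    refine dvd_add ih ?_
    have h := pow_succ_dvd_coeff_zero_flatPoly_mul_succ b n
    have h243 : (243 : ℤ) = 3 ^ 5 := by norm_num
    rw [h243]
    exact Dvd.dvd.mul_left (dvd_trans (pow_dvd_pow 3 (by omega)) h) 2

end ConstantTerms

/-! ## §2 Twist matrices with the `T¹`-invariant of the LOWER entry -/

section Twist

/-- `(p·q).coeff 1 = p(0)·q₁ + p₁·q(0)` (private plumbing). [folklore] -/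
private theorem coeff_one_mul' (p q : ℤ[X]) :
    (p * q).coeff 1 = p.coeff 0 * q.coeff 1 + p.coeff 1 * q.coeff 0 := by
  rw [coeff_mul, show (1 : ℕ) = 0 + 1 from rfl, Finset.Nat.antidiagonal_succ, Finset.sum_cons,
    Finset.Nat.antidiagonal_zero]
  simp

/-- `g = (T+1)^{3^n} + 1` has constant term `2` (private plumbing). [folklore] -/
private theorem coeff_zero_X_add_one_pow_add_one' (n : ℕ) :
    (((X + 1) ^ 3 ^ n + 1 : ℤ[X])).coeff 0 = 2 := by
  rw [coeff_add, coeff_X_add_one_pow, coeff_one_zero]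
  simp

variable {S : Type*} [CommRing S] (ψ : ℤ[X] →+* S) (σ : S →+* S) (b : ℤ)

/-- **The twist matrices with the `T¹`-invariant of `M₁₀`.** As `exists_twistMatrix_rowSeq` at `a = 3b`, with the
invariants `M_{00}(0) = 1`, `M_{10}(0) = 0` and `[T¹]M_{10} = −2·Σ_{m<n} v_m(0)v_{m+1}(0)` (`[T¹](E_{m+1})₁₀ =
−g(0)v_m(0)v_{m+1}(0)`, `g(0) = 2`). [cite: Sprung2017, §3.4 Prop. 3.14 and Cor. 4.4] -/
theorem exists_twistMatrix_rowSeq_lower (hC : σ (ψ (C (3 * b))) = ψ (C (3 * b)))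
    (hΦ : ∀ m : ℕ, ∃ w : S, σ (ψ ((cyclotomic (3 ^ (m + 1)) ℤ).comp (X + 1))) =
        w * ψ ((cyclotomic (3 ^ (m + 1)) ℤ).comp (X + 1)) ∧ ψ ((X + 1) ^ (2 * 3 ^ m)) * w = 1)
    (n : ℕ) :
    ∃ M : Matrix (Fin 2) (Fin 2) ℤ[X], ((M 0 0).coeff 0 = 1 ∧ (M 1 0).coeff 0 = 0 ∧
        (M 1 0).coeff 1 = -2 * ∑ m ∈ Finset.range n,
          (flatPoly (3 * b) 3 m).coeff 0 * (flatPoly (3 * b) 3 (m + 1)).coeff 0) ∧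
      ∀ m : ℕ, (m = n + 1 ∨ m = n) → ∀ i : Fin 2,
        ψ (rowSeq (3 * b) 3 i m) =
          ψ (M i 0) * σ (ψ (rowSeq (3 * b) 3 0 m)) + ψ (M i 1) * σ (ψ (rowSeq (3 * b) 3 1 m)) := by
  induction n with
  | zero =>
    refine ⟨1, ⟨by simp, by simp, by simp⟩, fun m hm i => ?_⟩
    rcases hm with rfl | rfl <;> fin_cases i <;> simp [rowSeq, Matrix.one_apply]
  | succ n ih =>
    obtain ⟨M, ⟨hM00, hM10z, hM10o⟩, hM⟩ := ih
    set a : ℤ := 3 * b with ha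
    set E : Matrix (Fin 2) (Fin 2) ℤ[X] :=
      !![1 - X * ((X + 1) ^ 3 ^ n + 1) * sharpPoly a 3 n * flatPoly a 3 (n + 1),
          X * ((X + 1) ^ 3 ^ n + 1) * sharpPoly a 3 n * sharpPoly a 3 (n + 1);
        -(X * ((X + 1) ^ 3 ^ n + 1) * flatPoly a 3 n * flatPoly a 3 (n + 1)),
          1 + X * ((X + 1) ^ 3 ^ n + 1) * flatPoly a 3 n * sharpPoly a 3 (n + 1)] with hEdef
    have hE00 : E 0 0 = 1 - X * ((X + 1) ^ 3 ^ n + 1) * sharpPoly a 3 n * flatPoly a 3 (n + 1) := rfl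
    have hE01 : E 0 1 = X * ((X + 1) ^ 3 ^ n + 1) * sharpPoly a 3 n * sharpPoly a 3 (n + 1) := rfl
    have hE10 : E 1 0 = -(X * ((X + 1) ^ 3 ^ n + 1) * flatPoly a 3 n * flatPoly a 3 (n + 1)) := rfl
    have hE11 : E 1 1 = 1 + X * ((X + 1) ^ 3 ^ n + 1) * flatPoly a 3 n * sharpPoly a 3 (n + 1) := rfl
    have hdet := X_mul_det_rowSeq a n
    have hP1 : ∀ i : Fin 2, E i 0 * sharpPoly a 3 (n + 1) + E i 1 * flatPoly a 3 (n + 1) = rowSeq a 3 i (n + 1) := by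
      intro i
      fin_cases i
      · simp only [Fin.zero_eta, Fin.isValue, hE00, hE01, rowSeq_zero]
        ring
      · simp only [Fin.mk_one, Fin.isValue, hE10, hE11, rowSeq_one]
        ring
    have hP2 : ∀ i : Fin 2, E i 0 * sharpPoly a 3 n + E i 1 * flatPoly a 3 n =
        (X + 1) ^ (2 * 3 ^ n) * rowSeq a 3 i n := by
      intro i
      fin_cases i
      · simp only [Fin.zero_eta, Fin.isValue, hE00, hE01, rowSeq_zero]
        linear_combination (((X + 1) ^ 3 ^ n + 1) * sharpPoly a 3 n) * hdet
      · simp only [Fin.mk_one, Fin.isValue, hE10, hE11, rowSeq_one]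
        linear_combination (((X + 1) ^ 3 ^ n + 1) * flatPoly a 3 n) * hdet
    have hU1 := hM (n + 1) (Or.inl rfl) 0
    have hV1 := hM (n + 1) (Or.inl rfl) 1
    have hU0 := hM n (Or.inr rfl) 0
    have hV0 := hM n (Or.inr rfl) 1
    simp only [rowSeq_zero, rowSeq_one] at hU1 hV1 hU0 hV0
    have hEM' : ∀ i l : Fin 2, (E * M) i l = E i 0 * M 0 l + E i 1 * M 1 l := fun i l => by
      rw [Matrix.mul_apply, Fin.sum_univ_two]
    have hE00z : (E 0 0).coeff 0 = 1 := by
      rw [hE00]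
      simp
    have hE11z : (E 1 1).coeff 0 = 1 := by
      rw [hE11]
      simp
    have hE01z : (E 0 1).coeff 0 = 0 := by
      rw [hE01]
      simp
    have hE10z : (E 1 0).coeff 0 = 0 := by
      rw [hE10]
      simp
    have hE10o : (E 1 0).coeff 1 = -2 * ((flatPoly a 3 n).coeff 0 * (flatPoly a 3 (n + 1)).coeff 0) := by
      rw [hE10, coeff_neg, mul_assoc, mul_assoc, coeff_X_mul, mul_coeff_zero, mul_coeff_zero,
        coeff_zero_X_add_one_pow_add_one']
      ring
    have hinv : ((E * M) 0 0).coeff 0 = 1 ∧ ((E * M) 1 0).coeff 0 = 0 ∧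
        ((E * M) 1 0).coeff 1 = -2 * ∑ m ∈ Finset.range (n + 1),
          (flatPoly (3 * b) 3 m).coeff 0 * (flatPoly (3 * b) 3 (m + 1)).coeff 0 := by
      refine ⟨?_, ?_, ?_⟩
      · rw [hEM', coeff_add, mul_coeff_zero, mul_coeff_zero, hM00, hE00z, hE01z, hM10z]
        ring
      · rw [hEM', coeff_add, mul_coeff_zero, mul_coeff_zero, hE10z, hM00, hE11z, hM10z]
        ring
      · rw [hEM', coeff_add, coeff_one_mul', coeff_one_mul', hE10z, hM00, hE10o, hE11z, hM10z, hM10o,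
          Finset.sum_range_succ, ← ha]
        ring
    refine ⟨E * M, hinv, fun m hm i => ?_⟩
    have hEM : ∀ l : Fin 2, (E * M) i l = E i 0 * M 0 l + E i 1 * M 1 l := fun l => by
      rw [Matrix.mul_apply, Fin.sum_univ_two]
    have hP1i := congrArg ψ (hP1 i)
    have hP2i := congrArg ψ (hP2 i)
    simp only [map_add, map_mul] at hP1i hP2i
    rw [rowSeq_zero, rowSeq_one, hEM 0, hEM 1]
    simp only [map_add, map_mul]
    rcases hm with rfl | rfl
    · obtain ⟨w, hw, hw1⟩ := hΦ n
      have hrow : rowSeq a 3 i (n + 1 + 1) =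
          C a * rowSeq a 3 i (n + 1) - (cyclotomic (3 ^ (n + 1)) ℤ).comp (X + 1) * rowSeq a 3 i n := by
        fin_cases i
        · exact sharpPoly_add_two a 3 n
        · exact flatPoly_add_two a 3 n
      rw [hrow, sharpPoly_add_two, flatPoly_add_two]
      simp only [map_sub, map_mul, hC, hw]
      linear_combination (ψ (C a) * ψ (E i 0)) * hU1 + (ψ (C a) * ψ (E i 1)) * hV1 +
        (-(w * ψ ((cyclotomic (3 ^ (n + 1)) ℤ).comp (X + 1)) * ψ (E i 0))) * hU0 +
        (-(w * ψ ((cyclotomic (3 ^ (n + 1)) ℤ).comp (X + 1)) * ψ (E i 1))) * hV0 +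
        (-ψ (C a)) * hP1i + (w * ψ ((cyclotomic (3 ^ (n + 1)) ℤ).comp (X + 1))) * hP2i +
        (ψ ((cyclotomic (3 ^ (n + 1)) ℤ).comp (X + 1)) * ψ (rowSeq a 3 i n)) * hw1
    · linear_combination ψ (E i 0) * hU1 + ψ (E i 1) * hV1 + (-1 : S) * hP1i

end Twist

/-! ## §3 The approximants with the lower invariant -/

section Approximants

/-- An integer polynomial read in `ℚ_3⟦T⟧` through `Λ` is its image through `ℚ` (private plumbing). [folklore] -/
private theorem coe_map_map_eq₃ (q : ℤ[X]) :
    (((q.map (Int.castRingHom ℚ)).map (algebraMap ℚ ℚ_[3]) : ℚ_[3][X]) : PowerSeries ℚ_[3]) =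
      (iwasawaToPowerSeries 3).comp (toIwasawa 3) q := by
  rw [RingHom.comp_apply]
  change _ = PowerSeries.map (algebraMap ℤ_[3] ℚ_[3])
    (((q.map (Int.castRingHom ℤ_[3])) : ℤ_[3][X]) : PowerSeries ℤ_[3])
  rw [← Polynomial.polynomial_map_coe, Polynomial.map_map, Polynomial.map_map,
    RingHom.ext_int ((algebraMap ℤ_[3] ℚ_[3]).comp (Int.castRingHom ℤ_[3]))
      ((algebraMap ℚ ℚ_[3]).comp (Int.castRingHom ℚ))]

/-- The image of `T + 1` (private plumbing). [folklore] -/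
private theorem psi_X_add_one₃ :
    (iwasawaToPowerSeries 3).comp (toIwasawa 3) (X + 1) = PowerSeries.X + 1 := by
  rw [← coe_map_map_eq₃]
  simp

/-- The image of a constant (private plumbing). [folklore] -/
private theorem psi_C₃ (c : ℤ) :
    (iwasawaToPowerSeries 3).comp (toIwasawa 3) (C c) = PowerSeries.C (c : ℚ_[3]) := by
  rw [← coe_map_map_eq₃, Polynomial.map_C, Polynomial.map_C, Polynomial.coe_C, eq_intCast, eq_ratCast,
    Rat.cast_intCast]

variable (b : ℤ)

/-- The entries of `A_n` read in `ℚ_3⟦T⟧` (private plumbing). [cite: Sprung2017, §3.1] -/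
private theorem coe_map_halfLogApprox_eq₃ (n : ℕ) (i k : Fin 2) :
    (((halfLogApprox 3 (3 * b) n i k).map (algebraMap ℚ ℚ_[3]) : ℚ_[3][X]) : PowerSeries ℚ_[3]) =
      (iwasawaToPowerSeries 3).comp (toIwasawa 3) (rowSeq (3 * b) 3 i (n + 1)) *
          PowerSeries.C ((((sprungCinv 3 (3 * b)) ^ (n + 2)) 0 k : ℚ) : ℚ_[3]) +
        (iwasawaToPowerSeries 3).comp (toIwasawa 3) (rowSeq (3 * b) 3 i n) *
          PowerSeries.C ((((sprungCinv 3 (3 * b)) ^ (n + 2)) 1 k : ℚ) : ℚ_[3]) := by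
  simp only [halfLogApprox, Polynomial.map_add, Polynomial.map_mul, Polynomial.map_C, Polynomial.coe_add,
    Polynomial.coe_mul, Polynomial.coe_C, coe_map_map_eq₃, eq_ratCast]

/-- **`A_n = M_n·A_n(T^ι)`** with the twist matrix of `exists_twistMatrix_rowSeq_lower`.
[cite: Sprung2017, §3.4 Prop. 3.14 and §3.1] -/
theorem exists_twistMatrix_halfLogApprox_lower (n : ℕ) :
    ∃ M : Matrix (Fin 2) (Fin 2) ℤ[X], ((M 0 0).coeff 0 = 1 ∧ (M 1 0).coeff 0 = 0 ∧
        (M 1 0).coeff 1 = -2 * ∑ m ∈ Finset.range n,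
          (flatPoly (3 * b) 3 m).coeff 0 * (flatPoly (3 * b) 3 (m + 1)).coeff 0) ∧ ∀ i k : Fin 2,
      (((halfLogApprox 3 (3 * b) n i k).map (algebraMap ℚ ℚ_[3]) : ℚ_[3][X]) : PowerSeries ℚ_[3]) =
        iwasawaToPowerSeries 3 (toIwasawa 3 (M i 0)) *
            PowerSeries.subst (invOnePlusSubOne : PowerSeries ℚ_[3])
              (((halfLogApprox 3 (3 * b) n 0 k).map (algebraMap ℚ ℚ_[3]) : ℚ_[3][X]) : PowerSeries ℚ_[3]) +
          iwasawaToPowerSeries 3 (toIwasawa 3 (M i 1)) *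
            PowerSeries.subst (invOnePlusSubOne : PowerSeries ℚ_[3])
              (((halfLogApprox 3 (3 * b) n 1 k).map (algebraMap ℚ ℚ_[3]) : ℚ_[3][X]) : PowerSeries ℚ_[3]) := by
  have hι := hasSubst_invOnePlusSubOne (R := ℚ_[3])
  set ψ : ℤ[X] →+* PowerSeries ℚ_[3] := (iwasawaToPowerSeries 3).comp (toIwasawa 3) with hψ
  set σ : PowerSeries ℚ_[3] →+* PowerSeries ℚ_[3] := (PowerSeries.substAlgHom hι).toRingHom with hσ
  have hσapp : ∀ x : PowerSeries ℚ_[3], σ x = PowerSeries.subst (invOnePlusSubOne : PowerSeries ℚ_[3]) x :=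
    fun x => by rw [hσ, AlgHom.toRingHom_eq_coe, RingHom.coe_coe, PowerSeries.coe_substAlgHom]
  have hC : σ (ψ (C (3 * b))) = ψ (C (3 * b)) := by
    rw [hψ, psi_C₃, PowerSeries.C_eq_algebraMap, hσ, AlgHom.toRingHom_eq_coe, RingHom.coe_coe, AlgHom.commutes]
  have hΦ : ∀ m : ℕ, ∃ w : PowerSeries ℚ_[3], σ (ψ ((cyclotomic (3 ^ (m + 1)) ℤ).comp (X + 1))) =
      w * ψ ((cyclotomic (3 ^ (m + 1)) ℤ).comp (X + 1)) ∧ ψ ((X + 1) ^ (2 * 3 ^ m)) * w = 1 := by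
    intro m
    refine ⟨(invOnePlusSubOne + 1 : PowerSeries ℚ_[3]) ^ (2 * 3 ^ m), ?_, ?_⟩
    · have hq : ψ ((cyclotomic (3 ^ (m + 1)) ℤ).comp (X + 1)) =
          (1 + PowerSeries.X : PowerSeries ℚ_[3]) ^ (2 * 3 ^ m) + (1 + PowerSeries.X) ^ 3 ^ m + 1 := by
        rw [cyclotomic_three_pow_succ_comp, map_add, map_add, map_pow, map_pow, map_one, hψ, psi_X_add_one₃,
          add_comm PowerSeries.X 1]
      rw [hq, hσapp, subst_invOnePlusSubOne_cyclotomicFactor]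
    · have hE : (1 + PowerSeries.X : PowerSeries ℚ_[3]) * (invOnePlusSubOne + 1) = 1 :=
        one_add_X_mul_invOnePlusSubOne_add_one
      rw [map_pow, hψ, psi_X_add_one₃, add_comm PowerSeries.X 1, ← mul_pow, hE, one_pow]
  obtain ⟨M, hinv, hM⟩ := exists_twistMatrix_rowSeq_lower ψ σ b hC hΦ n
  refine ⟨M, hinv, fun i k => ?_⟩
  have e1 := hM (n + 1) (Or.inl rfl) i
  have e0 := hM n (Or.inr rfl) i
  rw [coe_map_halfLogApprox_eq₃, coe_map_halfLogApprox_eq₃, coe_map_halfLogApprox_eq₃, ← hψ, ← hσapp, ← hσapp]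
  simp only [map_add, map_mul]
  have hc0 : σ (PowerSeries.C ((((sprungCinv 3 (3 * b)) ^ (n + 2)) 0 k : ℚ) : ℚ_[3])) =
      PowerSeries.C ((((sprungCinv 3 (3 * b)) ^ (n + 2)) 0 k : ℚ) : ℚ_[3]) := by
    rw [PowerSeries.C_eq_algebraMap, hσ, AlgHom.toRingHom_eq_coe, RingHom.coe_coe, AlgHom.commutes]
  have hc1 : σ (PowerSeries.C ((((sprungCinv 3 (3 * b)) ^ (n + 2)) 1 k : ℚ) : ℚ_[3])) =
      PowerSeries.C ((((sprungCinv 3 (3 * b)) ^ (n + 2)) 1 k : ℚ) : ℚ_[3]) := by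
    rw [PowerSeries.C_eq_algebraMap, hσ, AlgHom.toRingHom_eq_coe, RingHom.coe_coe, AlgHom.commutes]
  rw [hc0, hc1]
  linear_combination (PowerSeries.C ((((sprungCinv 3 (3 * b)) ^ (n + 2)) 0 k : ℚ) : ℚ_[3])) * e1 +
    (PowerSeries.C ((((sprungCinv 3 (3 * b)) ^ (n + 2)) 1 k : ℚ) : ℚ_[3])) * e0

end Approximants

/-! ## §4 The limit with the lower invariant -/

section Limit

/-- `[T^e] G(ι)` as a finite sum (private plumbing). [folklore] -/
private theorem coeff_subst_invOnePlusSubOne_eq_sum₃ (G : PowerSeries ℚ_[3]) (e : ℕ) :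
    PowerSeries.coeff e (PowerSeries.subst (invOnePlusSubOne : PowerSeries ℚ_[3]) G) =
      ∑ d ∈ Finset.range (e + 1), PowerSeries.coeff d G *
        PowerSeries.coeff e ((invOnePlusSubOne : PowerSeries ℚ_[3]) ^ d) := by
  have h0 : PowerSeries.constantCoeff (invOnePlusSubOne : PowerSeries ℚ_[3]) = 0 := constantCoeff_invOnePlusSubOne
  rw [PowerSeries.coeff_subst' (PowerSeries.HasSubst.of_constantCoeff_zero' h0),
    finsum_eq_sum_of_support_subset _ (s := Finset.range (e + 1)) ?_]
  · simp only [smul_eq_mul]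
  · intro d hd
    simp only [Function.mem_support, ne_eq, Finset.coe_range, Set.mem_Iio] at hd ⊢
    by_contra hlt
    apply hd
    rw [PowerSeries.coeff_of_lt_order e (lt_of_lt_of_le (by exact_mod_cast (by omega : e < d))
      (natCast_le_order_pow h0 d)), smul_zero]

/-- The integers `≡ c (mod 243)` form a closed subset of `ℤ_3` (private plumbing). [folklore] -/
private theorem isClosed_dvd243_sub (c : ℤ_[3]) : IsClosed {x : ℤ_[3] | (243 : ℤ_[3]) ∣ x - c} := by
  have h : {x : ℤ_[3] | (243 : ℤ_[3]) ∣ x - c} = Metric.closedBall c (((3 : ℕ) : ℝ) ^ (-((5 : ℕ) : ℤ))) := by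
    ext x
    rw [Set.mem_setOf_eq, Metric.mem_closedBall, dist_eq_norm,
      PadicInt.norm_le_pow_iff_mem_span_pow (x - c) 5, Ideal.mem_span_singleton]
    norm_num
  rw [h]
  exact Metric.isClosed_closedBall

/-- **`ℒ(T) = M(T)·ℒ(T^ι)` with `M ∈ M₂(ℤ_3⟦T⟧)` and `243 ∣ [T¹]M₁₀ − 108b`.** As
`exists_integral_halfLogMatrix_eq_mul_subst`, with the `T¹`-congruence of the lower off-diagonal entry (and
`M₀₀(0) = 1`, `M₁₀(0) = 0`). [cite: Sprung2017, §3.4 Prop. 3.14, Cor. 4.4 and Cor. 4.6] [cite: GreenbergLNM1716, §1] -/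
theorem exists_integral_halfLogMatrix_eq_mul_subst_lower (b : ℤ) :
    ∃ M : Matrix (Fin 2) (Fin 2) (PowerSeries ℤ_[3]),
      PowerSeries.constantCoeff (M 0 0) = 1 ∧ PowerSeries.constantCoeff (M 1 0) = 0 ∧
      (243 : ℤ_[3]) ∣ PowerSeries.coeff 1 (M 1 0) - 108 * (b : ℤ_[3]) ∧
      ∀ i k : Fin 2, halfLogMatrix b i k =
        iwasawaToPowerSeries 3 (M i 0) *
            PowerSeries.subst (invOnePlusSubOne : PowerSeries ℚ_[3]) (halfLogMatrix b 0 k) +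
          iwasawaToPowerSeries 3 (M i 1) *
            PowerSeries.subst (invOnePlusSubOne : PowerSeries ℚ_[3]) (halfLogMatrix b 1 k) := by
  classical
  choose Mn hinv hMn using exists_twistMatrix_halfLogApprox_lower b
  let s : ℕ → (Fin 2 → Fin 2 → ℕ → ℤ_[3]) := fun n i l j => (((Mn n i l).coeff j : ℤ) : ℤ_[3])
  obtain ⟨a, φ, hφ, ha⟩ := SeqCompactSpace.tendsto_subseq s
  have haZ : ∀ (i l : Fin 2) (j : ℕ), Tendsto (fun n => s (φ n) i l j) atTop (𝓝 (a i l j)) := fun i l j =>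
    tendsto_pi_nhds.mp (tendsto_pi_nhds.mp (tendsto_pi_nhds.mp ha i) l) j
  have ha' : ∀ (i l : Fin 2) (j : ℕ),
      Tendsto (fun n => (((Mn (φ n) i l).coeff j : ℤ) : ℚ_[3])) atTop (𝓝 ((a i l j : ℤ_[3]) : ℚ_[3])) := by
    intro i l j
    have h4 := (continuous_subtype_val.tendsto (a i l j)).comp (haZ i l j)
    refine h4.congr fun n => ?_
    simp [s, Function.comp]
  have hconstlim : ∀ (i l : Fin 2) (c : ℤ), (∀ n, (Mn n i l).coeff 0 = c) → a i l 0 = c := by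
    intro i l c hn
    have hconst : Tendsto (fun n => s (φ n) i l 0) atTop (𝓝 (c : ℤ_[3])) := by
      have : (fun n => s (φ n) i l 0) = fun _ => (c : ℤ_[3]) := by
        funext n
        simp [s, hn (φ n)]
      rw [this]
      exact tendsto_const_nhds
    exact tendsto_nhds_unique (haZ i l 0) hconst
  have h243 : (243 : ℤ_[3]) ∣ a 1 0 1 - 108 * (b : ℤ_[3]) := by
    have hmem : ∀ᶠ n in atTop, s (φ n) 1 0 1 ∈ {x : ℤ_[3] | (243 : ℤ_[3]) ∣ x - 108 * (b : ℤ_[3])} := by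
      refine Filter.eventually_atTop.2 ⟨4, fun n hn => ?_⟩
      have hφn : 4 ≤ φ n := le_trans hn hφ.le_apply
      obtain ⟨q, hq⟩ := dvd_two_mul_sum_flat_add b (φ n) hφn
      have hc : (Mn (φ n) 1 0).coeff 1 - 108 * b = 243 * (-q) := by
        rw [(hinv (φ n)).2.2]
        linarith
      show (243 : ℤ_[3]) ∣ (((Mn (φ n) 1 0).coeff 1 : ℤ) : ℤ_[3]) - 108 * (b : ℤ_[3])
      exact ⟨((-q : ℤ) : ℤ_[3]), by exact_mod_cast hc⟩
    exact (isClosed_dvd243_sub _).mem_of_tendsto (haZ 1 0 1) hmem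
  refine ⟨fun i l => PowerSeries.mk (a i l), ?_, ?_, ?_, fun i k => ?_⟩
  · rw [← PowerSeries.coeff_zero_eq_constantCoeff_apply, PowerSeries.coeff_mk]
    exact_mod_cast hconstlim 0 0 1 (fun n => (hinv n).1)
  · rw [← PowerSeries.coeff_zero_eq_constantCoeff_apply, PowerSeries.coeff_mk]
    exact_mod_cast hconstlim 1 0 0 (fun n => (hinv n).2.1)
  · rw [PowerSeries.coeff_mk]
    exact h243
  ext j
  let T : (ℕ → ℚ_[3]) → (ℕ → ℚ_[3]) → ℚ_[3] := fun f g =>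
    ∑ x ∈ Finset.HasAntidiagonal.antidiagonal j, f x.1 *
      ∑ d ∈ Finset.range (x.2 + 1), g d * PowerSeries.coeff x.2 ((invOnePlusSubOne : PowerSeries ℚ_[3]) ^ d)
  have hT : ∀ F G : PowerSeries ℚ_[3],
      PowerSeries.coeff j (F * PowerSeries.subst (invOnePlusSubOne : PowerSeries ℚ_[3]) G) =
        T (fun d => PowerSeries.coeff d F) (fun d => PowerSeries.coeff d G) := by
    intro F G
    simp only [T, PowerSeries.coeff_mul, coeff_subst_invOnePlusSubOne_eq_sum₃]
  have hTlim : ∀ {f g : ℕ → ℕ → ℚ_[3]} {f₀ g₀ : ℕ → ℚ_[3]},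
      (∀ d, Tendsto (fun n => f n d) atTop (𝓝 (f₀ d))) → (∀ d, Tendsto (fun n => g n d) atTop (𝓝 (g₀ d))) →
        Tendsto (fun n => T (f n) (g n)) atTop (𝓝 (T f₀ g₀)) := by
    intro f g f₀ g₀ hf hg
    exact tendsto_finsetSum _ fun x _ =>
      (hf x.1).mul (tendsto_finsetSum _ fun d _ => (hg d).mul_const _)
  have hcM : ∀ (n : ℕ) (i l : Fin 2) (d : ℕ),
      PowerSeries.coeff d (iwasawaToPowerSeries 3 (toIwasawa 3 (Mn n i l))) = (((Mn n i l).coeff d : ℤ) : ℚ_[3]) := by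
    intro n i l d
    change PowerSeries.coeff d (PowerSeries.map (algebraMap ℤ_[3] ℚ_[3])
      ((((Mn n i l).map (Int.castRingHom ℤ_[3])) : ℤ_[3][X]) : PowerSeries ℤ_[3])) = _
    rw [PowerSeries.coeff_map, Polynomial.coeff_coe, Polynomial.coeff_map]
    simp
  have hcMlim : ∀ (i l : Fin 2) (d : ℕ),
      PowerSeries.coeff d (iwasawaToPowerSeries 3 (PowerSeries.mk (a i l))) = ((a i l d : ℤ_[3]) : ℚ_[3]) := by
    intro i l d
    rw [PowerSeries.coeff_map, PowerSeries.coeff_mk]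
    rfl
  have hlhs : Tendsto (fun n => coeffSeq b (φ n) i k j) atTop (𝓝 (PowerSeries.coeff j (halfLogMatrix b i k))) :=
    (tendsto_coeffSeq b i k j).comp hφ.tendsto_atTop
  have heq : ∀ n : ℕ, coeffSeq b (φ n) i k j =
      T (fun d => (((Mn (φ n) i 0).coeff d : ℤ) : ℚ_[3])) (fun d => coeffSeq b (φ n) 0 k d) +
        T (fun d => (((Mn (φ n) i 1).coeff d : ℤ) : ℚ_[3])) (fun d => coeffSeq b (φ n) 1 k d) := by
    intro n
    have h := congrArg (PowerSeries.coeff j) (hMn (φ n) i k)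
    rw [coeff_coe_map_halfLogApprox, map_add, hT, hT] at h
    simp only [hcM, coeff_coe_map_halfLogApprox] at h
    exact h
  have hrhs : Tendsto (fun n => coeffSeq b (φ n) i k j) atTop
      (𝓝 (T (fun d => ((a i 0 d : ℤ_[3]) : ℚ_[3])) (fun d => PowerSeries.coeff d (halfLogMatrix b 0 k)) +
        T (fun d => ((a i 1 d : ℤ_[3]) : ℚ_[3])) (fun d => PowerSeries.coeff d (halfLogMatrix b 1 k)))) := by
    simp_rw [heq]
    exact (hTlim (ha' i 0) fun d => (tendsto_coeffSeq b 0 k d).comp hφ.tendsto_atTop).add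
      (hTlim (ha' i 1) fun d => (tendsto_coeffSeq b 1 k d).comp hφ.tendsto_atTop)
  have hlim := tendsto_nhds_unique hlhs hrhs
  rw [hlim, map_add, hT, hT]
  simp only [hcMlim]

end Limit

/-! ## §5 Uniqueness of the transition matrix -/

section Unique

/-- `ι ∘ ι = id` on `ℚ_3⟦T⟧` (private plumbing). [folklore] -/
private theorem subst_subst_rat₅ (g : PowerSeries ℚ_[3]) :
    PowerSeries.subst (invOnePlusSubOne : PowerSeries ℚ_[3])
      (PowerSeries.subst (invOnePlusSubOne : PowerSeries ℚ_[3]) g) = g := by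
  have hι := hasSubst_invOnePlusSubOne (R := ℚ_[3])
  rw [PowerSeries.subst_comp_subst_apply hι hι, invOnePlusSubOne_subst_self, PowerSeries.X_subst]

/-- `det ℒ(0) = 1/9 ≠ 0` (private plumbing). [cite: Sprung2017, §3.1 (ℒ(0) = C⁻²)] -/
private theorem det_halfLogMatrix_ne_zero₅ (b : ℤ) :
    halfLogMatrix b 0 0 * halfLogMatrix b 1 1 - halfLogMatrix b 0 1 * halfLogMatrix b 1 0 ≠ 0 := by
  intro h
  have h0 := congrArg PowerSeries.constantCoeff h
  rw [map_sub, map_mul, map_mul, constantCoeff_halfLogMatrix, constantCoeff_halfLogMatrix,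
    constantCoeff_halfLogMatrix, constantCoeff_halfLogMatrix, map_zero] at h0
  have hdetQ : (sprungCinv 3 (3 * b) ^ 2).det = 1 / 9 := by
    rw [Matrix.det_pow, Matrix.det_fin_two]
    simp [sprungCinv]
    norm_num
  have hcast : (((sprungCinv 3 (3 * b) ^ 2).det : ℚ) : ℚ_[3]) = 0 := by
    rw [Matrix.det_fin_two]
    push_cast
    linear_combination h0
  rw [hdetQ] at hcast
  norm_num at hcast

/-- **The integral transition matrix of `ℒ = M·ℒ(T^ι)` is UNIQUE** (`M = ℒ·ℒ(T^ι)⁻¹` over the fraction field: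
`det ℒ(T^ι) = (det ℒ)(T^ι) ≠ 0` in the domain `ℚ_3⟦T⟧`, and `Λ → ℚ_3⟦T⟧` is injective).
[cite: Sprung2017, §3.4 Prop. 3.14 and Cor. 4.6] [cite: GreenbergLNM1716, §1] -/
theorem halfLogMatrix_transition_unique (b : ℤ) {M M' : Matrix (Fin 2) (Fin 2) (PowerSeries ℤ_[3])}
    (hM : ∀ i k : Fin 2, halfLogMatrix b i k =
        iwasawaToPowerSeries 3 (M i 0) *
            PowerSeries.subst (invOnePlusSubOne : PowerSeries ℚ_[3]) (halfLogMatrix b 0 k) +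
          iwasawaToPowerSeries 3 (M i 1) *
            PowerSeries.subst (invOnePlusSubOne : PowerSeries ℚ_[3]) (halfLogMatrix b 1 k))
    (hM' : ∀ i k : Fin 2, halfLogMatrix b i k =
        iwasawaToPowerSeries 3 (M' i 0) *
            PowerSeries.subst (invOnePlusSubOne : PowerSeries ℚ_[3]) (halfLogMatrix b 0 k) +
          iwasawaToPowerSeries 3 (M' i 1) *
            PowerSeries.subst (invOnePlusSubOne : PowerSeries ℚ_[3]) (halfLogMatrix b 1 k)) :
    M = M' := by
  have hι := hasSubst_invOnePlusSubOne (R := ℚ_[3])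
  set τ : PowerSeries ℚ_[3] →+* PowerSeries ℚ_[3] := (PowerSeries.substAlgHom hι).toRingHom with hτ
  have hτapp : ∀ x : PowerSeries ℚ_[3], τ x = PowerSeries.subst (invOnePlusSubOne : PowerSeries ℚ_[3]) x :=
    fun x => by rw [hτ, AlgHom.toRingHom_eq_coe, RingHom.coe_coe, PowerSeries.coe_substAlgHom]
  have hττ : ∀ x, τ (τ x) = x := fun x => by rw [hτapp, hτapp, subst_subst_rat₅]
  -- `det ℒ(T^ι) ≠ 0`
  have hdet : τ (halfLogMatrix b 0 0) * τ (halfLogMatrix b 1 1) -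
      τ (halfLogMatrix b 0 1) * τ (halfLogMatrix b 1 0) ≠ 0 := by
    intro h
    apply det_halfLogMatrix_ne_zero₅ b
    have h' := congrArg τ h
    rw [map_sub, map_mul, map_mul, hττ, hττ, hττ, hττ, map_zero] at h'
    exact h'
  -- the rows of `D = ψ(M) − ψ(M′)` are killed by `ℒ(T^ι)`
  set D : Matrix (Fin 2) (Fin 2) (PowerSeries ℚ_[3]) :=
    fun i l => iwasawaToPowerSeries 3 (M i l) - iwasawaToPowerSeries 3 (M' i l) with hD
  have hrow : ∀ i k : Fin 2, D i 0 * τ (halfLogMatrix b 0 k) + D i 1 * τ (halfLogMatrix b 1 k) = 0 := by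
    intro i k
    have h1 := hM i k
    have h2 := hM' i k
    rw [← hτapp, ← hτapp] at h1 h2
    simp only [hD]
    linear_combination h2 - h1
  apply Matrix.ext
  intro i l
  apply iwasawaToPowerSeries_injective 3
  rw [← sub_eq_zero]
  change D i l = 0
  have h0 := hrow i 0
  have h1 := hrow i 1
  fin_cases l
  · have : D i 0 * (τ (halfLogMatrix b 0 0) * τ (halfLogMatrix b 1 1) -
        τ (halfLogMatrix b 0 1) * τ (halfLogMatrix b 1 0)) = 0 := by
      linear_combination τ (halfLogMatrix b 1 1) * h0 - τ (halfLogMatrix b 1 0) * h1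
    exact (mul_eq_zero.mp this).resolve_right hdet
  · have : D i 1 * (τ (halfLogMatrix b 0 0) * τ (halfLogMatrix b 1 1) -
        τ (halfLogMatrix b 0 1) * τ (halfLogMatrix b 1 0)) = 0 := by
      linear_combination τ (halfLogMatrix b 0 0) * h1 - τ (halfLogMatrix b 0 1) * h0
    exact (mul_eq_zero.mp this).resolve_right hdet

end Unique

/-! ## §6 Both off-diagonal entries, for `3 ∤ b` -/

section Both

/-- In `ℤ_3`: `(3 : ℤ_3) ∣ (k : ℤ)` iff `3 ∣ k` in `ℤ` (private plumbing). [folklore] -/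
private theorem three_dvd_intCast_iff' (k : ℤ) : (3 : ℤ_[3]) ∣ (k : ℤ_[3]) ↔ (3 : ℤ) ∣ k := by
  have h1 := PadicInt.norm_lt_one_iff_dvd (p := 3) (k : ℤ_[3])
  have h2 := PadicInt.norm_int_lt_one_iff_dvd (p := 3) k
  push_cast at h1 h2
  exact h1.symm.trans h2

/-- **`M₀₁ = 3T·(unit)` AND `M₁₀ = 3T·g` with `g(0) ≠ 0` (`3 ∤ b`)** — both off-diagonal invariants for the unique
integral transition matrix of `ℒ = M·ℒ(T^ι)` (`81 ∣ g(0) − 36b`), together with `M₀₀(0) = M₁₁(0) = 1`.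
[cite: Sprung2017, §3.4 Prop. 3.14, Cor. 4.4 and Cor. 4.6] [cite: GreenbergLNM1716, §1] -/
theorem exists_integral_halfLogMatrix_offDiag_both (b : ℤ) (hb : ¬ (3 : ℤ) ∣ b) :
    ∃ M : Matrix (Fin 2) (Fin 2) (PowerSeries ℤ_[3]),
      (∃ u : PowerSeries ℤ_[3], IsUnit u ∧ M 0 1 = PowerSeries.C (3 : ℤ_[3]) * PowerSeries.X * u) ∧
      (∃ g : PowerSeries ℤ_[3], PowerSeries.constantCoeff g ≠ 0 ∧
        M 1 0 = PowerSeries.C (3 : ℤ_[3]) * PowerSeries.X * g) ∧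
      PowerSeries.constantCoeff (M 0 0) = 1 ∧ PowerSeries.constantCoeff (M 1 1) = 1 ∧
      ∀ i k : Fin 2, halfLogMatrix b i k =
        iwasawaToPowerSeries 3 (M i 0) *
            PowerSeries.subst (invOnePlusSubOne : PowerSeries ℚ_[3]) (halfLogMatrix b 0 k) +
          iwasawaToPowerSeries 3 (M i 1) *
            PowerSeries.subst (invOnePlusSubOne : PowerSeries ℚ_[3]) (halfLogMatrix b 1 k) := by
  obtain ⟨M, hu, hM10, hM00, hM11, hM10z, hM⟩ := exists_integral_halfLogMatrix_offDiag_eq_C_mul_X_mul_unit b hb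
  obtain ⟨M', -, -, h243, hM'⟩ := exists_integral_halfLogMatrix_eq_mul_subst_lower b
  have hMM' : M = M' := halfLogMatrix_transition_unique b hM hM'
  rw [← hMM'] at h243
  refine ⟨M, hu, ?_, hM00, hM11, hM⟩
  -- `M₁₀ = C(3)·X·g`, `g(0) = [T¹]M₁₀ / 3`
  choose g hg using hM10
  have hg0 : g 0 = 0 := by
    have h := hg 0
    rw [PowerSeries.coeff_zero_eq_constantCoeff_apply, hM10z] at h
    rcases mul_eq_zero.mp h.symm with h3 | h00
    · exact absurd h3 (by norm_num)
    · exact h00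
  refine ⟨PowerSeries.mk fun j => g (j + 1), ?_, ?_⟩
  · -- `243 ∣ 3·g 1 − 108b` with `3 ∤ b` forces `g 1 ≠ 0`
    rw [← PowerSeries.coeff_zero_eq_constantCoeff_apply, PowerSeries.coeff_mk, zero_add]
    intro hg1
    obtain ⟨q, hq⟩ := h243
    rw [hg 1, hg1, mul_zero, zero_sub] at hq
    apply hb
    have h3 : ((4 * b : ℤ) : ℤ_[3]) * 27 = 3 * (-(3 * q)) * 27 := by
      push_cast
      linear_combination -hq
    have h4b : (3 : ℤ_[3]) ∣ ((4 * b : ℤ) : ℤ_[3]) :=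
      ⟨-(3 * q), mul_right_cancel₀ (by norm_num : (27 : ℤ_[3]) ≠ 0) h3⟩
    have h4b' := (three_dvd_intCast_iff' (4 * b)).mp h4b
    have hcop : IsCoprime (3 : ℤ) 4 := ⟨-1, 1, by norm_num⟩
    exact hcop.dvd_of_dvd_mul_left h4b'
  · ext j
    rw [mul_assoc, PowerSeries.coeff_C_mul, hg j]
    rcases j with _ | j
    · rw [PowerSeries.coeff_zero_X_mul, hg0, mul_zero]
    · rw [PowerSeries.coeff_succ_X_mul, PowerSeries.coeff_mk]

end Both



end Literature.NumberTheory.EllipticCurves.Sprung2017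

end
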